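import Summits.CriticalPhenomena.PercolationContinuityZ3.Theorems.PercNearOneGluingNoHeavyLowerTailIncStarCutVertex
import Summits.CriticalPhenomena.PercolationContinuityZ3.Theorems.PercNearOneGluingNoHeavyLowerTailSahiBlobCore
import Summits.CriticalPhenomena.PercolationContinuityZ3.Theorems.PercNearOneGluingNoHeavyLowerTailSahiPrincipalAntichain
import Literature.Probability.LatticeModels.ProdBernoulliClusterLocality
import HarnessLib

/-!
# Tools for the reduction of the increasing star to irreducible marked graphs

Support file for the Sahi programme (`--supports stmt-CriticalPhenomena-4575`, prover prim-sahi-p2 gen 12).  No definitions, no named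
facts, no sorries; standard axioms.  Memo `…/prim-sahi-p2/PROOF-E3.md` §23.

Plumbing for `…IncStarIrreducible` (the theorem "the increasing star `E₃({s↔a},{s↔b},{s↔c}) ≥ 0` holds on every finite weighted graph as
soon as it holds on every IRREDUCIBLE marked weighted graph"):
* `sahiE3_congr_of_agree`: two triples of events that agree on every configuration of positive weight have the same `E₃`;
* `sahiE3_openConn_eq_openConnIn_of_no_exit`: if no pair of positive weight leaves `S ∋ x`, the star of `x` may be computed inside `S`;
* `sahiE3_openConnIn_congr_weight`: the star inside `S` depends only on the weights of the off-diagonal pairs inside `S`;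
* `incStar_openConnIn_of_fin`: TRANSPORT — if the increasing star holds for every weight on `Fin m`, then it holds inside every
  `m`-element vertex set `S` of any finite weighted graph (restriction of the weight to `S`, no-exit, core pull-back
  `SahiBlobReduction.exists_coreReduce` along an enumeration of `S`);
* `incStar_of_not_distinct`: the star is trivial when two of the four marks coincide (two generators:
  `SahiPrincipalAntichain.sahiE_principal_twoTargetSets`).
-/

noncomputable section

namespace Summit.CriticalPhenomena.PercolationContinuityZ3.Theorems

namespace IncStarIrreducible

open Finset MeasureTheory Literature.Combinatorics.Sahi2008 Literature.Probability.Percolation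
  Literature.Probability.LatticeModels
open Literature.Probability.Percolation.DecisionTree (ind ind_of_mem ind_of_not_mem ind_nonneg)
open Literature.Probability.Percolation.BlockExploration (exists_openWalk_of_mem_openConnIn
  mem_openConn_iff_openConnIn_univ)
open scoped Classical

variable {V : Type*} [Fintype V]

/-! ### `E₃` congruences -/

/-- The order-3 Sahi functional of three events as `sahiE` of the indicator family (plumbing). [folklore] -/
theorem sahiE3_eq_sahiE_ind (w : Sym2 V → unitInterval) (A B C : Set (BondConfig V)) :
    sahiE3 (prodBernoulli w) A B C = sahiE (bernoulliWeight w) 3 (fun i => ind ((![A, B, C] : Fin 3 → Set (BondConfig V)) i)) := by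
  have hf : (fun i => ind ((![A, B, C] : Fin 3 → Set (BondConfig V)) i)) = ![ind A, ind B, ind C] := by
    funext i; fin_cases i <;> rfl
  rw [hf, sahiE_three_ind]

/-- **Two triples of events that agree on every configuration of positive weight have the same `E₃`.** [this work] -/
theorem sahiE3_congr_of_agree (w : Sym2 V → unitInterval) {A₁ A₂ A₃ B₁ B₂ B₃ : Set (BondConfig V)}
    (h : ∀ ω : BondConfig V, bernoulliWeight w ω ≠ 0 → ((ω ∈ A₁ ↔ ω ∈ B₁) ∧ (ω ∈ A₂ ↔ ω ∈ B₂) ∧ (ω ∈ A₃ ↔ ω ∈ B₃))) :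
    sahiE3 (prodBernoulli w) A₁ A₂ A₃ = sahiE3 (prodBernoulli w) B₁ B₂ B₃ := by
  rw [sahiE3_eq_sahiE_ind, sahiE3_eq_sahiE_ind]
  refine TwoChainUnions.sahiE_congr_of_prodMoments (bernoulliWeight w) (bernoulliWeight w) 3 _ _ fun S => ?_
  rw [ex_def, ex_def]
  refine Finset.sum_congr rfl fun ω _ => ?_
  by_cases hωw : bernoulliWeight w ω = 0
  · rw [hωw, zero_mul, zero_mul]
  · congr 1
    rw [Finset.prod_apply, Finset.prod_apply]
    refine Finset.prod_congr rfl fun i _ => ?_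
    have hi : ω ∈ (![A₁, A₂, A₃] : Fin 3 → Set (BondConfig V)) i ↔ ω ∈ (![B₁, B₂, B₃] : Fin 3 → Set (BondConfig V)) i := by
      obtain ⟨h1, h2, h3⟩ := h ω hωw
      fin_cases i
      exacts [h1, h2, h3]
    by_cases hm : ω ∈ (![A₁, A₂, A₃] : Fin 3 → Set (BondConfig V)) i
    · rw [ind_of_mem hm, ind_of_mem (hi.1 hm)]
    · rw [ind_of_not_mem hm, ind_of_not_mem (fun h' => hm (hi.2 h'))]

/-- **No exit: the star may be computed inside `S`.**  If every pair from `S` to `Sᶜ` has weight `0` and `x ∈ S`, then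
`E₃({x↔t₁},{x↔t₂},{x↔t₃}) = E₃({x↔t₁ in S},{x↔t₂ in S},{x↔t₃ in S})`. [this work] -/
theorem sahiE3_openConn_eq_openConnIn_of_no_exit (w : Sym2 V → unitInterval) (S : Set V)
    (hS : ∀ y ∈ S, ∀ z ∉ S, w s(y, z) = 0) {x : V} (hx : x ∈ S) (t₁ t₂ t₃ : V) :
    sahiE3 (prodBernoulli w) (openConn x t₁) (openConn x t₂) (openConn x t₃) =
      sahiE3 (prodBernoulli w) (openConnIn S x t₁) (openConnIn S x t₂) (openConnIn S x t₃) := by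
  refine sahiE3_congr_of_agree w fun ω hω => ?_
  have hN : ∀ u ∈ S, ∀ v ∉ S, s(u, v) ∉ ω := fun u hu v hv hmem =>
    hω (IncStarCycle.bernoulliWeight_eq_zero_of_mem w hmem (hS u hu v hv))
  exact ⟨SahiBlobReduction.openConn_iff_openConnIn_of_no_exit hN hx,
    SahiBlobReduction.openConn_iff_openConnIn_of_no_exit hN hx,
    SahiBlobReduction.openConn_iff_openConnIn_of_no_exit hN hx⟩

/-- **The star inside `S` depends only on the weights of the off-diagonal pairs inside `S`.** [this work] -/
theorem sahiE3_openConnIn_congr_weight (w w' : Sym2 V → unitInterval) (S : Set V)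
    (h : ∀ e : Sym2 V, ¬ e.IsDiag → (∀ z ∈ e, z ∈ S) → w e = w' e) (x t₁ t₂ t₃ : V) :
    sahiE3 (prodBernoulli w) (openConnIn S x t₁) (openConnIn S x t₂) (openConnIn S x t₃) =
      sahiE3 (prodBernoulli w') (openConnIn S x t₁) (openConnIn S x t₂) (openConnIn S x t₃) := by
  set F : Set (Sym2 V) := {z : Sym2 V | ¬ z.IsDiag ∧ ∀ v ∈ z, v ∈ S} with hF
  have hpq : ∀ e ∈ F, w e = w' e := fun e he => h e he.1 he.2
  have hd : ∀ t : V, DeterminedBy (openConnIn S x t : Set (BondConfig V)) F :=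
    fun t => IncStarCutVertex.determinedBy_openConnIn_offDiag S x t
  have hm : ∀ X : Set (BondConfig V), MeasurableSet X := fun _ => MeasurableSet.of_discrete
  have key : ∀ A : Set (BondConfig V), DeterminedBy A F → (prodBernoulli w).real A = (prodBernoulli w').real A :=
    fun A hA => prodBernoulli_real_eq_of_determinedBy w w' hpq hA (hm A)
  rw [sahiE3_def, sahiE3_def, key _ (hd t₁), key _ (hd t₂), key _ (hd t₃), key _ ((hd t₁).inter (hd t₂)),
    key _ ((hd t₁).inter (hd t₃)), key _ ((hd t₂).inter (hd t₃)), key _ (((hd t₁).inter (hd t₂)).inter (hd t₃))]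

/-! ### Transport from `Fin m` to an `m`-element vertex set -/

omit [Fintype V] in
/-- The star with all three targets equal to the root is `0`: `E₃(Ω,Ω,Ω) = 2 + 1 − 3`. [folklore] -/
theorem sahiE3_univ_univ_univ (w : Sym2 V → unitInterval) :
    sahiE3 (prodBernoulli w) (Set.univ : Set (BondConfig V)) Set.univ Set.univ = 0 := by
  rw [sahiE3_def]; simp only [Set.inter_self, probReal_univ]; ring

/-- `E₃` of three root-connection events as the order-3 Sahi functional of the singleton-target principal family
(plumbing, the shape used by `SahiBlobReduction.exists_coreReduce`). [folklore] -/
theorem sahiE3_openConn_eq_sahiE_singletons (w : Sym2 V → unitInterval) (s a b c : V) :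
    sahiE3 (prodBernoulli w) (openConn s a) (openConn s b) (openConn s c) =
      sahiE (bernoulliWeight w) 3 (fun i => ind (⋂ t ∈ (![{a}, {b}, {c}] : Fin 3 → Finset V) i,
        (openConn s t : Set (BondConfig V)))) := by
  have hf : (fun i : Fin 3 => ind (⋂ t ∈ (![{a}, {b}, {c}] : Fin 3 → Finset V) i,
      (openConn s t : Set (BondConfig V)))) = ![ind (openConn s a), ind (openConn s b), ind (openConn s c)] := by
    funext i; fin_cases i <;> simp
  rw [hf, sahiE_three_ind]

/-- **Transport.**  If the increasing star holds for every weight on `Fin m` (all roots and targets), then for every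
finite weighted graph and every `m`-element vertex set `S` it holds INSIDE `S`:
`0 ≤ E₃({x↔t₁ in S},{x↔t₂ in S},{x↔t₃ in S})` for `x, tᵢ ∈ S`.  (Restrict the weight to the pairs inside `S`
— the events do not notice —, then no pair leaves `S`, so the events are the plain connection events, and the core
pull-back along an enumeration `Fin m ≃ S` lands in `Fin m`.) [this work] -/
theorem incStar_openConnIn_of_fin {m : ℕ}
    (P : ∀ (w₀ : Sym2 (Fin m) → unitInterval) (s a b c : Fin m),
      0 ≤ sahiE3 (prodBernoulli w₀) (openConn s a) (openConn s b) (openConn s c))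
    (w : Sym2 V → unitInterval) (S : Finset V) (hS : S.card = m) {x t₁ t₂ t₃ : V}
    (hx : x ∈ S) (h₁ : t₁ ∈ S) (h₂ : t₂ ∈ S) (h₃ : t₃ ∈ S) :
    0 ≤ sahiE3 (prodBernoulli w) (openConnIn (↑S : Set V) x t₁) (openConnIn (↑S : Set V) x t₂)
      (openConnIn (↑S : Set V) x t₃) := by
  -- restrict the weight to the pairs inside `S`
  obtain ⟨wS, hwS⟩ : ∃ wS : Sym2 V → unitInterval, ∀ e, wS e = if ∀ z ∈ e, z ∈ S then w e else 0 :=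
    ⟨_, fun e => rfl⟩
  have hagree : ∀ e : Sym2 V, ¬ e.IsDiag → (∀ z ∈ e, z ∈ (↑S : Set V)) → w e = wS e := by
    intro e _ he
    rw [hwS, if_pos (fun z hz => Finset.mem_coe.1 (he z hz))]
  rw [sahiE3_openConnIn_congr_weight w wS (↑S) hagree]
  -- under `wS` no pair leaves `S`
  have hwS0 : ∀ y, y ∉ S → ∀ z, wS s(y, z) = 0 := fun y hy z => by
    rw [hwS, if_neg (fun hall => hy (hall y (Sym2.mem_mk_left y z)))]
  have hexit : ∀ y ∈ (↑S : Set V), ∀ z ∉ (↑S : Set V), wS s(y, z) = 0 := by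
    intro y _ z hz
    rw [Sym2.eq_swap]
    exact hwS0 z (fun h => hz (Finset.mem_coe.2 h)) y
  rw [← sahiE3_openConn_eq_openConnIn_of_no_exit wS (↑S) hexit (Finset.mem_coe.2 hx)]
  -- degenerate size: `S = {x}`
  rcases Nat.lt_or_ge m 2 with hm | hm
  · have hS1 : ∀ y ∈ S, y = x := by
      intro y hy
      by_contra hyx
      have hsub : ({x, y} : Finset V) ⊆ S := by
        intro z hz
        rcases Finset.mem_insert.1 hz with rfl | hz
        · exact hx
        · rw [Finset.mem_singleton] at hz; exact hz ▸ hy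
      have h2 := Finset.card_le_card hsub
      rw [Finset.card_pair (Ne.symm hyx), hS] at h2
      omega
    have ht : ∀ {t : V}, t ∈ S → (openConn x t : Set (BondConfig V)) = Set.univ := by
      intro t ht
      rw [hS1 t ht]
      exact Set.eq_univ_of_forall fun ω => SimpleGraph.Reachable.refl _
    rw [ht h₁, ht h₂, ht h₃, sahiE3_univ_univ_univ]
  -- enumerate `S` and pull back to `Fin m`
  have hcard : Fintype.card (↥S) = m := by rw [Fintype.card_coe, hS]
  let e : ↥S ≃ Fin m := Fintype.equivFinOfCardEq hcard
  let c : Fin m → V := fun i => ((e.symm i : ↥S) : V)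
  have hc : Function.Injective c := fun i j hij => e.symm.injective (Subtype.ext hij)
  have hrange : ∀ y : V, y ∈ Set.range c → y ∈ S := by
    rintro y ⟨i, rfl⟩; exact (e.symm i).2
  have h01 : ((⟨0, by omega⟩ : Fin m)) ≠ ⟨1, by omega⟩ := by
    intro h; exact absurd (congrArg Fin.val h) (by norm_num)
  obtain ⟨w₀, hw₀⟩ := SahiBlobReduction.exists_coreReduce wS hc
    (fun _ => s((⟨0, by omega⟩ : Fin m), (⟨1, by omega⟩ : Fin m)))
    (fun y _ => by rw [Sym2.mk_isDiag_iff]; exact h01)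
    (fun y hy z hne => (hne (hwS0 y (fun hyS => hy ⟨e ⟨y, hyS⟩, by simp [c]⟩) z)).elim)
  have hcx : c (e ⟨x, hx⟩) = x := by simp [c]
  have hc₁ : c (e ⟨t₁, h₁⟩) = t₁ := by simp [c]
  have hc₂ : c (e ⟨t₂, h₂⟩) = t₂ := by simp [c]
  have hc₃ : c (e ⟨t₃, h₃⟩) = t₃ := by simp [c]
  have key := hw₀ (e ⟨x, hx⟩) 3 ![{e ⟨t₁, h₁⟩}, {e ⟨t₂, h₂⟩}, {e ⟨t₃, h₃⟩}]
  have hfam : (fun k : Fin 3 => ind (⋂ t ∈ (![{e ⟨t₁, h₁⟩}, {e ⟨t₂, h₂⟩}, {e ⟨t₃, h₃⟩}] : Fin 3 → Finset (Fin m)) k,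
      (openConn (c (e ⟨x, hx⟩)) (c t) : Set (BondConfig V)))) =
      fun k : Fin 3 => ind (⋂ t ∈ (![{t₁}, {t₂}, {t₃}] : Fin 3 → Finset V) k,
        (openConn x t : Set (BondConfig V))) := by
    funext k; fin_cases k <;> simp [hcx, hc₁, hc₂, hc₃]
  rw [hfam] at key
  rw [sahiE3_openConn_eq_sahiE_singletons, key, ← sahiE3_openConn_eq_sahiE_singletons]
  exact P w₀ _ _ _ _

/-! ### Degenerate marks -/

omit [Fintype V] in
/-- `{s ↔ s}` is the sure event. [folklore] -/
theorem openConn_self (s : V) : (openConn s s : Set (BondConfig V)) = Set.univ :=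
  Set.eq_univ_of_forall fun _ => SimpleGraph.Reachable.refl _

/-- **A target equal to the root**: `0 ≤ E₃({s↔s},{s↔b},{s↔c}) = Cov(1_{s↔b}, 1_{s↔c})` (Harris; here from the
two-generator theorem `SahiPrincipalAntichain.sahiE_principal_twoTargetSets`). [folklore] -/
theorem incStar_root_target (w : Sym2 V → unitInterval) (s b c : V) :
    0 ≤ sahiE3 (prodBernoulli w) (openConn s s) (openConn s b) (openConn s c) := by
  have h := SahiPrincipalAntichain.sahiE_principal_twoTargetSets w s ![{b}, {c}] 3 ![∅, {0}, {1}]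
  have hf : (fun i : Fin 3 => ind (⋂ j ∈ (![∅, {0}, {1}] : Fin 3 → Finset (Fin 2)) i,
      ⋂ t ∈ (![{b}, {c}] : Fin 2 → Finset V) j, (openConn s t : Set (BondConfig V)))) =
      fun i => ind ((![openConn s s, openConn s b, openConn s c] : Fin 3 → Set (BondConfig V)) i) := by
    funext i; fin_cases i <;> simp [openConn_self]
  rw [hf] at h
  rwa [sahiE3_eq_sahiE_ind]

/-- **Two equal targets**: `0 ≤ E₃({s↔a},{s↔a},{s↔c})` (two generators). [folklore] -/
theorem incStar_targets_eq (w : Sym2 V → unitInterval) (s a c : V) :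
    0 ≤ sahiE3 (prodBernoulli w) (openConn s a) (openConn s a) (openConn s c) := by
  have h := SahiPrincipalAntichain.sahiE_principal_twoTargetSets w s ![{a}, {c}] 3 ![{0}, {0}, {1}]
  have hf : (fun i : Fin 3 => ind (⋂ j ∈ (![{0}, {0}, {1}] : Fin 3 → Finset (Fin 2)) i,
      ⋂ t ∈ (![{a}, {c}] : Fin 2 → Finset V) j, (openConn s t : Set (BondConfig V)))) =
      fun i => ind ((![openConn s a, openConn s a, openConn s c] : Fin 3 → Set (BondConfig V)) i) := by
    funext i; fin_cases i <;> simp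
  rw [hf] at h
  rwa [sahiE3_eq_sahiE_ind]

/-- **Coincident marks are trivial**: if two of `s, a, b, c` coincide then `0 ≤ E₃({s↔a},{s↔b},{s↔c})`. [folklore] -/
theorem incStar_of_not_distinct (w : Sym2 V → unitInterval) {s a b c : V}
    (h : s = a ∨ s = b ∨ s = c ∨ a = b ∨ a = c ∨ b = c) :
    0 ≤ sahiE3 (prodBernoulli w) (openConn s a) (openConn s b) (openConn s c) := by
  rcases h with rfl | rfl | rfl | rfl | rfl | rfl
  · exact incStar_root_target w s b c
  · rw [sahiE3_comm₁₂]; exact incStar_root_target w s a c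
  · rw [sahiE3_comm₂₃, sahiE3_comm₁₂]; exact incStar_root_target w s a b
  · exact incStar_targets_eq w s a c
  · rw [sahiE3_comm₂₃]; exact incStar_targets_eq w s a b
  · rw [sahiE3_comm₁₂, sahiE3_comm₂₃]; exact incStar_targets_eq w s b a

end IncStarIrreducible

end Summit.CriticalPhenomena.PercolationContinuityZ3.Theorems
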